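import Summits.FinalStateConjecture.FinalStateConjecture.Statement
import Literature.Geometry.Lorentzian.CausalityPushUp
import HarnessLib

/-!
# Crux `DispersingCapture` (stmt-FinalStateConjecture-17643), line `registered` (birth r4) —
# stub `stub_orientedAssembly` (B₂b, the final assembly of the witness)

Boosted, Statement-shaped settled data on a vacuum Cauchy development `𝒟` — sub-extremal labels
`(Mᵢ, aᵢ)`; a flat chart `Φ₀` on `U₁` which is a late chart into `O` after `T₁`, `C²`-flat on
whole flat slabs and with `dΦ₀(∂₀)` eventually future-directed on whole flat slabs; honest growing
radii `Rᵢ → ∞`, `Rᵢ ≥ max(r₊, 0) + 1`; hole charts `ψᵢ` on the boosted Kerr exteriors (late charts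
into `O` after `T₁`, `C²` convergence out to `Rᵢ(τ)`, separation at every radius); sublinear
excision radii whose straight tubes cut `U₁` out of the late half-space; orthochronous motions and
oriented hole slabs; the region identity `O = J⁺(ι X) ∩ I⁻(Φ₀(late T₁) ∪ ⋃ᵢ ψᵢ(late T₁))`; and
exhaustion of `O` in the `certifiedLate`/`certifiedSlab` shape for every `τ₁ > T₁` — together
with the ray clause (R) for `O`, give the conclusion of the re-typed Statement for `𝒟`:

* witness: `O' := O` and the decomposition `d` with exactly these charts, restarted at chart time
  `T₁ + 1` (so that the structure's covering clause is the exhaustion hypothesis at `T₁ + 1`;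
  fixed-radius near-zone convergence follows from convergence out to `Rᵢ(τ) → ∞` by monotonicity
  of the truncated deviation in the radius);
* `O = exteriorOf 𝒟 d.charted`: `⊇` by monotonicity of `I⁻` (`d.charted ⊆` the charted region at
  `T₁`); `⊆` because, by exhaustion at `T₁ + 2`, every point of the charted region at `T₁` lies in
  `d.charted` or in `J⁻(certified slab at T₁ + 2) ⊆ J⁻(d.charted)`, whence
  `I⁻(charted at T₁) ⊆ I⁻(J⁻(d.charted)) = I⁻(d.charted)` by push-up (O'Neill's Cor. 14.1,
  `LorentzianMetric.chronologicalFuture_causalFuture_eq_of_boundaryless` in the reversed time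
  orientation);
* `RaysStayInClosure 𝒟 O'` is (R) verbatim; `HasExhaustiveCharts d` is witnessed by the radii
  `Rᵢ` themselves (exhaustion hypothesis at every `τ₁ > T₁ + 1`); `IsFutureOriented d` is the
  three orientation hypotheses verbatim.

Pure set/causal plumbing over `FinalStateDecomposition` (`KerrConvergence.lean`) and the
Statement's auxiliaries; cf. `stub_settlesOfConverges`
(`Theorems/ClusterCompletenessLinearToNonlinearCaptureStubSettlesOfConverges.lean`) and the landed
`N = 0` branch `stub_captureNoHoles` of this crux.

References: Dafermos–Luk arXiv:1710.01722, Conjecture 1; O'Neill 1983, Ch. 14, Cor. 14.1 and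
Lemma 14.3; DHRT arXiv:2104.08222, §1.
-/

set_option linter.dupNamespace false

noncomputable section

open scoped Manifold ContDiff Topology ENNReal
open Filter Set Function TopologicalSpace Literature.Geometry.Lorentzian

universe u

namespace Summit.FinalStateConjecture.FinalStateConjecture.Theorems.DissipativeFinalMotions.DispersingCapture

/-- A late region `{t > τ}` of a reference background with continuous time function is open in the
reference domain. [folklore] -/
private theorem isOpen_lateRegion_of_continuous_time (B : ModelBackground) (hB : Continuous B.time)
    (τ : ℝ) : IsOpen (B.lateRegion τ) :=
  isOpen_lt continuous_const (hB.comp continuous_subtype_val)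

/-- **Restarting a late chart at a later time.** A late chart after `τ₀` into `O` is a late chart
after any `τ₁ ≥ τ₀` into any region `O'` containing the image of the late region `{t > τ₁}`,
provided that late region is open (the open embedding restricts along the open inclusion
`{t > τ₁} ↪ {t > τ₀}`). [folklore] -/
private theorem isLateChart_restart {𝓢 : Spacetime.{u} 4} {B : ModelBackground}
    {O O' : Set 𝓢.carrier} {τ₀ τ₁ : ℝ} {Ψ : B.domain → 𝓢.carrier}
    (h : 𝓢.IsLateChart B O τ₀ Ψ) (hτ : τ₀ ≤ τ₁) (hopen : IsOpen (B.lateRegion τ₁))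
    (hO' : Ψ '' B.lateRegion τ₁ ⊆ O') : 𝓢.IsLateChart B O' τ₁ Ψ where
  contMDiff := h.contMDiff
  isOpenEmbedding := h.isOpenEmbedding.comp
    (Topology.IsOpenEmbedding.inclusion (B.lateRegion_mono hτ)
      (hopen.preimage continuous_subtype_val))
  image_subset := hO'

/-- **B₂b — ORIENTED ASSEMBLY** (final assembly of the witness of the crux `DispersingCapture`).
Boosted settled data — sub-extremal labels; flat chart `Φ₀` on `U₁` (late chart into `O` after
`T₁`, `C²`-flat on whole slabs, `dΦ₀(∂₀)` eventually future-directed on whole slabs); honest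
growing radii `Rᵢ`; hole charts `ψᵢ` on the boosted exteriors (late charts into `O` after `T₁`,
`C²` convergence out to `Rᵢ(τ)`, separation at every radius); sublinear excision radii whose
straight tubes cut `U₁` out of the late half-space; orthochronous motions and oriented hole
slabs; `O = exteriorOf 𝒟 (Φ₀(late T₁) ∪ ⋃ᵢ ψᵢ(late T₁))`; exhaustion of `O` in the
`certifiedLate`/`certifiedSlab` shape for every `τ₁ > T₁` — together with (R) for `O`, give the
crux's conclusion: the decomposition `d` with these charts restarted at `T₁ + 1` (fixed-radius
convergence from convergence out to `Rᵢ → ∞`, `truncDeviationCk_mono`; covering clause =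
exhaustion at `T₁ + 1`), the region `O' := O`, and `O = exteriorOf 𝒟 d.charted` (`⊇` by
monotonicity of `I⁻`; `⊆` by exhaustion at `T₁ + 2` and push-up `I⁻(J⁻ W) = I⁻ W`,
`chronologicalFuture_causalFuture_eq_of_boundaryless` in the reversed orientation);
`HasExhaustiveCharts d` with the radii `Rᵢ` is the exhaustion hypothesis verbatim,
`IsFutureOriented d` the three orientation hypotheses verbatim. Dafermos–Luk arXiv:1710.01722,
Conj. 1; O'Neill 1983, Ch. 14, Cor. 14.1, Lemma 14.3; DHRT arXiv:2104.08222, §1. -/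
theorem stub_orientedAssembly : open scoped Manifold Topology in ∀ (X : Type) [TopologicalSpace X] [ChartedSpace (EuclideanSpace ℝ (Fin 3)) X] [IsManifold (𝓡 3) ((⊤ : ℕ∞) : WithTop ℕ∞) X] [T2Space X] [SecondCountableTopology X] [ConnectedSpace X], ∀ (D : Literature.Geometry.Lorentzian.InitialDataSet (𝓡 3) X) (𝒟 : Literature.Geometry.Lorentzian.VacuumCauchyDevelopment D) (N : ℕ) (M a : Fin N → ℝ) (T₁ : ℝ) (O : Set 𝒟.carrier) (U₁ : TopologicalSpace.Opens Literature.Geometry.Lorentzian.E4) (Φ₀ : (Literature.Geometry.Lorentzian.Minkowski.backgroundOn U₁).domain → 𝒟.carrier) (mo : Fin N → Literature.Geometry.Lorentzian.lorentzGroup × Literature.Geometry.Lorentzian.E4) (ψ : (i : Fin N) → (Literature.Geometry.Lorentzian.boostedKerrBackground (mo i).1 (mo i).2 (M i) (a i)).domain → 𝒟.carrier) (ρexc : Fin N → ℝ → ℝ) (R : Fin N → ℝ → ℝ),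
    (∀ i, Literature.Geometry.Lorentzian.Kerr.IsSubextremal (M i) (a i)) →
    𝒟.toSpacetime.IsLateChart (Literature.Geometry.Lorentzian.Minkowski.backgroundOn U₁) O T₁ Φ₀ →
    Filter.Tendsto (fun τ ↦ 𝒟.toSpacetime.deviationCk (Literature.Geometry.Lorentzian.Minkowski.backgroundOn U₁) Φ₀ 2 τ) Filter.atTop (nhds 0) →
    (∀ᶠ τ in Filter.atTop, ∀ x ∈ (Literature.Geometry.Lorentzian.Minkowski.backgroundOn U₁).timeSlab τ, 𝒟.toSpacetime.timeOrientation.IsFutureDirected (mfderiv 𝓘(ℝ, Literature.Geometry.Lorentzian.E4) (𝓡 4) Φ₀ x (Literature.Geometry.Lorentzian.E4.basisVector 0))) →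
    (∀ i, Filter.Tendsto (R i) Filter.atTop Filter.atTop ∧ ∀ τ, max (Literature.Geometry.Lorentzian.Kerr.rPlus (M i) (a i)) 0 + 1 ≤ R i τ) →
    (∀ i, 𝒟.toSpacetime.IsLateChart (Literature.Geometry.Lorentzian.boostedKerrBackground (mo i).1 (mo i).2 (M i) (a i)) O T₁ (ψ i)) →
    (∀ i, Filter.Tendsto (fun τ ↦ 𝒟.toSpacetime.truncDeviationCk (Literature.Geometry.Lorentzian.boostedKerrBackground (mo i).1 (mo i).2 (M i) (a i)) (ψ i) 2 (R i τ) τ) Filter.atTop (nhds 0)) →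
    (∀ R' : ℝ, ∃ τ' : ℝ, Pairwise (Function.onFun Disjoint fun i ↦ ψ i '' (Literature.Geometry.Lorentzian.boostedKerrBackground (mo i).1 (mo i).2 (M i) (a i)).truncLateRegion τ' R')) →
    (∀ i, Filter.Tendsto (fun t ↦ ρexc i t / t) Filter.atTop (nhds 0)) →
    {x : Literature.Geometry.Lorentzian.E4 | T₁ < x 0 ∧ ∀ i, ρexc i (x 0) < Literature.Geometry.Lorentzian.Kerr.radius (a i) (Literature.Geometry.Lorentzian.poincareInv (mo i).1 (mo i).2 x)} ⊆ (U₁ : Set Literature.Geometry.Lorentzian.E4) →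
    (∀ i, Summit.FinalStateConjecture.IsOrthochronous (mo i).1) →
    (∀ i (ρ' : ℝ), ∀ᶠ τ in Filter.atTop, ∀ x ∈ (Literature.Geometry.Lorentzian.boostedKerrBackground (mo i).1 (mo i).2 (M i) (a i)).truncTimeSlab ρ' τ, 𝒟.toSpacetime.timeOrientation.IsFutureDirected (mfderiv 𝓘(ℝ, Literature.Geometry.Lorentzian.E4) (𝓡 4) (ψ i) x (((mo i).1 : Literature.Geometry.Lorentzian.E4 ≃L[ℝ] Literature.Geometry.Lorentzian.E4) (Literature.Geometry.Lorentzian.Kerr.timeVector (M i) (a i) (Literature.Geometry.Lorentzian.poincareInv (mo i).1 (mo i).2 (x : Literature.Geometry.Lorentzian.E4)))))) →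
    O = Summit.FinalStateConjecture.exteriorOf 𝒟.toCauchyDevelopment (Φ₀ '' (Literature.Geometry.Lorentzian.Minkowski.backgroundOn U₁).lateRegion T₁ ∪ ⋃ i, ψ i '' (Literature.Geometry.Lorentzian.boostedKerrBackground (mo i).1 (mo i).2 (M i) (a i)).lateRegion T₁) →
    (∀ τ₁, T₁ < τ₁ → O \ (Φ₀ '' (Literature.Geometry.Lorentzian.Minkowski.backgroundOn U₁).lateRegion τ₁ ∪ ⋃ i, ψ i '' {x : (Literature.Geometry.Lorentzian.boostedKerrBackground (mo i).1 (mo i).2 (M i) (a i)).domain | τ₁ < (Literature.Geometry.Lorentzian.boostedKerrBackground (mo i).1 (mo i).2 (M i) (a i)).time x.1 ∧ (Literature.Geometry.Lorentzian.boostedKerrBackground (mo i).1 (mo i).2 (M i) (a i)).radius x.1 ≤ R i ((Literature.Geometry.Lorentzian.boostedKerrBackground (mo i).1 (mo i).2 (M i) (a i)).time x.1)}) ⊆ 𝒟.toSpacetime.metric.causalPast 𝒟.toSpacetime.timeOrientation (Φ₀ '' (Literature.Geometry.Lorentzian.Minkowski.backgroundOn U₁).timeSlab τ₁ ∪ ⋃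 i, ψ i '' (Literature.Geometry.Lorentzian.boostedKerrBackground (mo i).1 (mo i).2 (M i) (a i)).truncTimeSlab (R i τ₁) τ₁)) →
    Summit.FinalStateConjecture.RaysStayInClosure 𝒟.toCauchyDevelopment O →
    ∃ (O' : Set 𝒟.carrier) (d : Literature.Geometry.Lorentzian.FinalStateDecomposition 𝒟.toSpacetime O' 2), (∀ i, Literature.Geometry.Lorentzian.Kerr.IsSubextremal (d.mass i) (d.spin i)) ∧ O' = Summit.FinalStateConjecture.exteriorOf 𝒟.toCauchyDevelopment d.charted ∧ Summit.FinalStateConjecture.RaysStayInClosure 𝒟.toCauchyDevelopment O' ∧ Summit.FinalStateConjecture.HasExhaustiveCharts d ∧ Summit.FinalStateConjecture.IsFutureOriented d := by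
  intro X _ _ _ _ _ _ D 𝒟 N M a T₁ O U₁ Φ₀ mo ψ ρexc R hsub hΦ₀ hflat hF₀ hR hψ hholes hsep hρexc
    hU₁ horth hFh hO hexh hrays
  have h1 : T₁ ≤ T₁ + 1 := (lt_add_one T₁).le
  -- continuity of the chart times and openness of the late regions
  have hcK : ∀ i, Continuous (boostedKerrBackground (mo i).1 (mo i).2 (M i) (a i)).time :=
    fun i ↦ (PiLp.continuous_apply 2 _ 0).comp (continuous_poincareInv _ _)
  have hc0 : Continuous (Minkowski.backgroundOn U₁).time := PiLp.continuous_apply 2 _ 0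
  have hoK : ∀ i (τ : ℝ),
      IsOpen ((boostedKerrBackground (mo i).1 (mo i).2 (M i) (a i)).lateRegion τ) :=
    fun i τ ↦ isOpen_lateRegion_of_continuous_time _ (hcK i) τ
  have ho0 : ∀ τ : ℝ, IsOpen ((Minkowski.backgroundOn U₁).lateRegion τ) :=
    fun τ ↦ isOpen_lateRegion_of_continuous_time _ hc0 τ
  -- the charted region at `T₁` lies in `O`
  have hC₀O : (Φ₀ '' (Minkowski.backgroundOn U₁).lateRegion T₁ ∪
      ⋃ i, ψ i '' (boostedKerrBackground (mo i).1 (mo i).2 (M i) (a i)).lateRegion T₁) ⊆ O :=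
    union_subset hΦ₀.image_subset (iUnion_subset fun i ↦ (hψ i).image_subset)
  -- the restarted charted region `C` (at `T₁ + 1`) lies in the charted region at `T₁`
  have hCC₀ : (Φ₀ '' (Minkowski.backgroundOn U₁).lateRegion (T₁ + 1) ∪
      ⋃ i, ψ i '' (boostedKerrBackground (mo i).1 (mo i).2 (M i) (a i)).lateRegion (T₁ + 1)) ⊆
      Φ₀ '' (Minkowski.backgroundOn U₁).lateRegion T₁ ∪
        ⋃ i, ψ i '' (boostedKerrBackground (mo i).1 (mo i).2 (M i) (a i)).lateRegion T₁ :=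
    union_subset_union (image_mono ((Minkowski.backgroundOn U₁).lateRegion_mono h1))
      (iUnion_mono fun i ↦ image_mono
        ((boostedKerrBackground (mo i).1 (mo i).2 (M i) (a i)).lateRegion_mono h1))
  -- the charted region at `T₁` lies in `J⁻(C)`, by exhaustion at `T₁ + 2`
  have hC₀J : (Φ₀ '' (Minkowski.backgroundOn U₁).lateRegion T₁ ∪
      ⋃ i, ψ i '' (boostedKerrBackground (mo i).1 (mo i).2 (M i) (a i)).lateRegion T₁) ⊆
      𝒟.metric.causalPast 𝒟.timeOrientation
        (Φ₀ '' (Minkowski.backgroundOn U₁).lateRegion (T₁ + 1) ∪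
          ⋃ i, ψ i '' (boostedKerrBackground (mo i).1 (mo i).2 (M i) (a i)).lateRegion
            (T₁ + 1)) := by
    intro q hq
    have h12 : T₁ + 1 < T₁ + 2 := by linarith
    have h02 : T₁ < T₁ + 2 := by linarith
    by_cases hq2 : q ∈ Φ₀ '' (Minkowski.backgroundOn U₁).lateRegion (T₁ + 2) ∪
        ⋃ i, ψ i '' {x | T₁ + 2 <
          (boostedKerrBackground (mo i).1 (mo i).2 (M i) (a i)).time x.1 ∧
          (boostedKerrBackground (mo i).1 (mo i).2 (M i) (a i)).radius x.1 ≤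
            R i ((boostedKerrBackground (mo i).1 (mo i).2 (M i) (a i)).time x.1)}
    · refine LorentzianMetric.subset_causalPast 𝒟.metric 𝒟.timeOrientation _ ?_
      rcases hq2 with hq0 | hqi
      · exact Or.inl (image_mono ((Minkowski.backgroundOn U₁).lateRegion_mono h12.le) hq0)
      · obtain ⟨i, hi⟩ := mem_iUnion.1 hqi
        exact Or.inr (mem_iUnion.2 ⟨i, image_mono (fun x hx ↦ h12.trans hx.1) hi⟩)
    · exact LorentzianMetric.causalFuture_mono (τ := 𝒟.timeOrientation.reverse)
        (union_subset_union
          (image_mono ((Minkowski.backgroundOn U₁).timeSlab_subset_lateRegion h12))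
          (iUnion_mono fun i ↦ image_mono
            (((boostedKerrBackground (mo i).1 (mo i).2 (M i) (a i)).truncTimeSlab_subset_timeSlab
              _ _).trans ((boostedKerrBackground (mo i).1 (mo i).2 (M i)
                (a i)).timeSlab_subset_lateRegion h12))))
        (hexh (T₁ + 2) h02 ⟨hC₀O hq, hq2⟩)
  -- `O = J⁺(ι X) ∩ I⁻(C)`: `⊆` by push-up `I⁻(J⁻ C) = I⁻ C`, `⊇` by monotonicity of `I⁻`
  have hOC : O = Summit.FinalStateConjecture.exteriorOf 𝒟.toCauchyDevelopment
      (Φ₀ '' (Minkowski.backgroundOn U₁).lateRegion (T₁ + 1) ∪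
        ⋃ i, ψ i '' (boostedKerrBackground (mo i).1 (mo i).2 (M i) (a i)).lateRegion
          (T₁ + 1)) := by
    refine Subset.antisymm (fun p hp ↦ ?_) ?_
    · rw [hO] at hp
      refine ⟨hp.1, ?_⟩
      have h2 := LorentzianMetric.chronologicalFuture_mono (τ := 𝒟.timeOrientation.reverse)
        hC₀J hp.2
      exact (LorentzianMetric.chronologicalFuture_causalFuture_eq_of_boundaryless
        (τ := 𝒟.timeOrientation.reverse) (by exact_mod_cast le_top)
        (Φ₀ '' (Minkowski.backgroundOn U₁).lateRegion (T₁ + 1) ∪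
          ⋃ i, ψ i '' (boostedKerrBackground (mo i).1 (mo i).2 (M i) (a i)).lateRegion
            (T₁ + 1))).subset h2
    · rw [hO]
      exact inter_subset_inter_right _ (LorentzianMetric.chronologicalFuture_mono hCC₀)
  -- near-zone convergence for every fixed radius, from convergence out to `Rᵢ(τ) → ∞`
  have htrunc : ∀ i (R' : ℝ), Tendsto (fun τ ↦ 𝒟.toSpacetime.truncDeviationCk
      (boostedKerrBackground (mo i).1 (mo i).2 (M i) (a i)) (ψ i) 2 R' τ) atTop (𝓝 0) :=
    fun i R' ↦ tendsto_of_tendsto_of_tendsto_of_le_of_le' tendsto_const_nhds (hholes i)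
      (Eventually.of_forall fun _ ↦ zero_le)
      (((hR i).1.eventually_ge_atTop R').mono fun τ hτ ↦
        𝒟.toSpacetime.truncDeviationCk_mono
          (boostedKerrBackground (mo i).1 (mo i).2 (M i) (a i)) (ψ i) 2 hτ τ)
  -- the decomposition: the same charts, restarted at `T₁ + 1`, on `O' := O`
  let d : FinalStateDecomposition 𝒟.toSpacetime O 2 :=
    { N := N
      mass := M
      spin := a
      mass_pos := fun i ↦ (hsub i).pos
      abs_spin_le_mass := fun i ↦ le_of_lt (hsub i)
      motion := mo
      τ₀ := T₁ + 1
      chart := ψ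
      isLateChart := fun i ↦ isLateChart_restart (hψ i) h1 (hoK i _)
        ((image_mono ((boostedKerrBackground (mo i).1 (mo i).2 (M i) (a i)).lateRegion_mono
          h1)).trans (hψ i).image_subset)
      tendsto_truncDeviationCk := htrunc
      exists_pairwise_disjoint := hsep
      excision := ρexc
      tendsto_excision_div := hρexc
      flatDomain := U₁
      setOf_lt_excision_subset_flatDomain := fun x hx ↦ hU₁ ⟨(lt_add_one T₁).trans hx.1, hx.2⟩
      flatChart := Φ₀
      isLateChart_flat := isLateChart_restart hΦ₀ h1 (ho0 _)
        ((image_mono ((Minkowski.backgroundOn U₁).lateRegion_mono h1)).trans hΦ₀.image_subset)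
      tendsto_deviationCk_flat := hflat
      diff_subset_causalPast := by
        -- covering clause at `T₁ + 1`, from exhaustion of `O` at `T₁ + 1`
        rintro p ⟨hpO, hpC⟩
        have hp : p ∈ O \ (Φ₀ '' (Minkowski.backgroundOn U₁).lateRegion (T₁ + 1) ∪
            ⋃ i, ψ i '' {x | T₁ + 1 <
              (boostedKerrBackground (mo i).1 (mo i).2 (M i) (a i)).time x.1 ∧
              (boostedKerrBackground (mo i).1 (mo i).2 (M i) (a i)).radius x.1 ≤
                R i ((boostedKerrBackground (mo i).1 (mo i).2 (M i) (a i)).time x.1)}) := by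
          refine ⟨hpO, ?_⟩
          rintro (hp0 | hpi)
          · exact hpC (Or.inr hp0)
          · obtain ⟨i, hi⟩ := mem_iUnion.1 hpi
            exact hpC (Or.inl (mem_iUnion.2 ⟨i, image_mono (fun x hx ↦ hx.1) hi⟩))
        exact LorentzianMetric.causalFuture_mono (τ := 𝒟.timeOrientation.reverse)
          (union_subset subset_union_right (subset_union_of_subset_left
            (iUnion_mono fun i ↦ image_mono ((boostedKerrBackground (mo i).1 (mo i).2 (M i)
              (a i)).truncTimeSlab_subset_timeSlab _ _)) _))
          (hexh (T₁ + 1) (lt_add_one T₁) hp) }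
  refine ⟨O, d, hsub, hOC, hrays, ⟨R, hR, hholes, fun τ₁ hτ₁ ↦ ?_⟩, horth, hFh, hF₀⟩
  -- exhaustion for `τ₁ > T₁ + 1`: the hypothesis at `τ₁ > T₁`
  have hτ : T₁ < τ₁ := by
    have hτ' : T₁ + 1 < τ₁ := hτ₁
    linarith
  exact hexh τ₁ hτ

end Summit.FinalStateConjecture.FinalStateConjecture.Theorems.DissipativeFinalMotions.DispersingCapture

end
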